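import Summits.ValiantsHypothesis.ValiantsHypothesis.Theorems.KPlusLogSqLawTropicalCycleMonotone
import Summits.ValiantsHypothesis.ValiantsHypothesis.Theorems.KPlusLogSqLawTropicalBScaleCarries

/-!
# Route «KPlusLogSqLaw», crux `TropicalB` (stmt-ValiantsHypothesis-19771) — THE SCALE-CARRY LAW, CYCLEWISE AND CHARGED:
# only scale-carries containing a LONG exchange cycle cost, and each costs only its actual potential drop

HONEST FRAMING.  Helper toward the registered stubs `stub_tropThin` / `stub_tropFat` / `stub_tropTowerLog` of
`Cruxes/TropicalB/Lines/birth.lean` (crux `…Theses.KPlusLogSqLaw.TropicalB`, item `stmt-ValiantsHypothesis-19771`, route `KPlusLogSqLaw`;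
cell `pub-symmetroid`, seat val-sym-trop-p1 g10, 2026-08-27; `--supports … --as helper`).  Part 3 of the scale-carry law (parts 1–2:
`…TropicalBScaleCarriesLex`, `…TropicalBScaleCarries`; setting, `Ψ` and `R := (mΔ+1)·m·W(s−1) + mΔ` as there), refined CYCLE BY CYCLE with
the tree's cyclewise slope law `sum_d_lt_of_isDominant_invariant` (…TropicalCycleMonotone).  A bookkeeping law for dominant chains of designs
with `c`-SEPARATED exponent scales; nothing here bounds `TropicalB` for general exponent vectors or in its window; nothing on `WeakLifting`, the
doors, `MatrixDescartes` (stmt-ValiantsHypothesis-18050) or VP ≠ VNP.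

* `psiOn_lt_of_short_invariant` — for consecutive unique optima `p = (σ, λ)`, `q = (σ', λ')` and a column set `J` invariant under `σ⁻¹σ'`
  on which they differ and on which `≤ c` columns change class, the `J`-part of `Ψ` rises by `≥ 1` (relative bridges `…_on` + part 1's
  `lexStep`); `psi_lt_of_shortCover` — a labelling `π` of the columns invariant under `σ⁻¹σ'` all of whose fibres re-class `≤ c` columns makes
  the step free (`Ψ p + 1 ≤ Ψ q`) whatever the total number of re-classed columns; the finest invariant labelling is the orbit labelling, so
  a step is free as soon as EACH exchange cycle of `σ⁻¹σ'` re-classes `≤ c` columns.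
* `chain_succ_le_of_longCycleCarries` — **CYCLEWISE LAW**: `n + 1 ≤ (R + 1)·(1 + #bad)`, `bad` = scale-carries admitting NO invariant
  labelling with all fibres short (⊆ part 2's long scale-carries, as the constant labelling is invariant): simultaneous short cycles are free.
* `card_not_le_add_sum_drop`, `psi_le_psi_add_mul_card_ne`, `chain_le_add_sum_charge` — **CHARGED FORM**: a bad step costs only its actual
  drop `≤ ((mΔ+1)·W(s−1) + Δ)·ℓ_k` (`ℓ_k` = columns re-classed at step `k`): `n ≤ R + Σ_{k bad} (((mΔ+1)·W(s−1) + Δ)·ℓ_k + 1)` — with every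
  class its own scale, `Δ = 0`, `c = 1`, `W = id` this is the carry-restricted form of the displacement law (…Displacement).
READING (construction side): in a `c`-separated lexicographic design a chain longer than `(R+1)(L+1)` performs more than `L` carries each
containing ONE exchange cycle through more than `c` re-classed columns; register gadgets assembled from bounded-length cycles (any number in
parallel) cannot produce super-`m·(c+1)^s` chains; SHIFT-THREE's `m − 1` carries are single `m`-cycles re-classing `2, …, m` columns.
[folklore-level potential argument; the packaging is the cell's]
-/

set_option linter.dupNamespace false
set_option autoImplicit false

namespace Summit.ValiantsHypothesis.ValiantsHypothesis.Theorems.KPlusLogSqLaw.ScaleCarries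

open Summit.ValiantsHypothesis.ValiantsHypothesis.Theorems.MatrixDescartes.Negative
open Summit.ValiantsHypothesis.ValiantsHypothesis.Theorems.LacunarySymmetroidMatrixDescartes
open Summit.ValiantsHypothesis.ValiantsHypothesis.Theorems.LacunarySymmetroidMatrixDescartes.TropicalCensus
open scoped BigOperators
open Finset

/-! ## 1. Scale profiles RELATIVE to a column set `J` -/

section Relative
variable {m K : ℕ}

/-- fiberwise evaluation on `J`. [folklore] -/
theorem sum_eq_sum_card_mul_on {s : ℕ} (J : Finset (Fin m)) (f : Fin m → ℕ) (hf : ∀ b, f b < s) (X : ℕ → ℕ) :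
    ∑ b ∈ J, X (f b) = ∑ t ∈ range s, (J.filter fun b => f b = t).card * X t := by
  rw [← sum_fiberwise_of_maps_to (s := J) (t := range s) (g := f) (fun b _ => mem_range.mpr (hf b))
    (f := fun b => X (f b))]
  refine sum_congr rfl fun t _ => ?_
  rw [sum_congr rfl (g := fun _ => X t) (fun b hb => by rw [(mem_filter.mp hb).2]), sum_const, smul_eq_mul]

/-- the relative scale profile has total mass `#J`. [folklore] -/
theorem sum_card_fiber_on {s : ℕ} (J : Finset (Fin m)) (f : Fin m → ℕ) (hf : ∀ b, f b < s) :
    ∑ t ∈ range s, (J.filter fun b => f b = t).card = J.card := by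
  have h := sum_eq_sum_card_mul_on J f hf (fun _ => 1)
  simp only [mul_one, sum_const, smul_eq_mul] at h
  exact h.symm

/-- relative positive part ≤ number of columns of `J` whose scale changed. [folklore] -/
theorem sum_card_tsub_le_card_ne_on {s : ℕ} (J : Finset (Fin m)) (f f' : Fin m → ℕ) (hf' : ∀ b, f' b < s) :
    ∑ t ∈ range s, ((J.filter fun b => f' b = t).card - (J.filter fun b => f b = t).card) ≤
      (J.filter fun b => f' b ≠ f b).card := by
  classical
  have hle : ∀ t, (J.filter fun b => f' b = t).card - (J.filter fun b => f b = t).card ≤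
      ((J.filter fun b => f' b ≠ f b).filter fun b => f' b = t).card := by
    intro t
    have hsub : (J.filter fun b => f' b = t) ⊆
        (J.filter fun b => f b = t) ∪ ((J.filter fun b => f' b ≠ f b).filter fun b => f' b = t) := by
      intro b hb
      simp only [mem_filter, mem_union] at hb ⊢
      by_cases h : f b = t
      · exact Or.inl ⟨hb.1, h⟩
      · exact Or.inr ⟨⟨hb.1, by rw [hb.2]; exact Ne.symm h⟩, hb.2⟩
    have := (card_le_card hsub).trans (card_union_le _ _)
    omega
  calc ∑ t ∈ range s, ((J.filter fun b => f' b = t).card - (J.filter fun b => f b = t).card)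
      ≤ ∑ t ∈ range s, ((J.filter fun b => f' b ≠ f b).filter fun b => f' b = t).card := sum_le_sum fun t _ => hle t
    _ = (J.filter fun b => f' b ≠ f b).card :=
        (card_eq_sum_card_fiberwise (f := f') fun b _ => mem_range.mpr (hf' b)).symm

/-- a bounded summand changes the `J`-sum by at most `Δ` per changed column of `J`. [folklore] -/
theorem sum_le_sum_add_mul_card_ne_on (J : Finset (Fin m)) (r₁ r₂ : Fin m → Fin K) (g : Fin K → ℕ) (Δ : ℕ)
    (hg : ∀ l, g l ≤ Δ) :
    ∑ b ∈ J, g (r₂ b) ≤ ∑ b ∈ J, g (r₁ b) + Δ * (J.filter fun b => r₂ b ≠ r₁ b).card := by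
  classical
  rw [← sum_filter_add_sum_filter_not J (fun b => r₂ b ≠ r₁ b) (fun b => g (r₂ b)),
    ← sum_filter_add_sum_filter_not J (fun b => r₂ b ≠ r₁ b) (fun b => g (r₁ b))]
  have h1 : ∑ b ∈ J.filter (fun b => r₂ b ≠ r₁ b), g (r₂ b) ≤ Δ * (J.filter fun b => r₂ b ≠ r₁ b).card := by
    calc ∑ b ∈ J.filter (fun b => r₂ b ≠ r₁ b), g (r₂ b) ≤ ∑ b ∈ J.filter (fun b => r₂ b ≠ r₁ b), Δ :=
          sum_le_sum fun b _ => hg _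
      _ = Δ * (J.filter fun b => r₂ b ≠ r₁ b).card := by rw [sum_const, smul_eq_mul, mul_comm]
  have h2 : ∑ b ∈ J.filter (fun b => ¬ r₂ b ≠ r₁ b), g (r₂ b) = ∑ b ∈ J.filter (fun b => ¬ r₂ b ≠ r₁ b), g (r₁ b) :=
    sum_congr rfl fun b hb => by
      have : r₂ b = r₁ b := by simpa using (mem_filter.mp hb).2
      rw [this]
  omega

end Relative
/-! ## 2. The potential rises on every short invariant block, hence at every step with a short invariant cover -/

section Blocks
variable {m K : ℕ}

/-- **SHORT INVARIANT BLOCK ⇒ ITS POTENTIAL RISES**: for consecutive unique optima `p`, `q` and a `σ⁻¹σ′`-invariant column set `J` on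
which they differ and on which at most `c` columns change class, the `J`-part of `Ψ` rises by `≥ 1` (cyclewise slope law
`sum_d_lt_of_isDominant_invariant` + part 1's `lexStep` on `J`). [this file] -/
theorem psiOn_lt_of_short_invariant {s : ℕ} (c Δ : ℕ) (hc : 1 ≤ c) (sc : Fin K → ℕ) (hsc : ∀ l, sc l < s) (B W : ℕ → ℕ)
    (d : Fin K → ℕ) (hd : ∀ l, B (sc l) ≤ d l ∧ d l ≤ B (sc l) + Δ)
    (hB : ∀ t t', t < t' → t' < s → c * (B t + Δ) < B t')
    (hW : ∀ t t', t < t' → t' < s → c * W t + 1 ≤ W t')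
    (v ε : Fin m → Fin m → Fin K → ℤ) {θa θb : ℤ} (hab : θa < θb)
    {p q : Equiv.Perm (Fin m) × (Fin m → Fin K)} (hp : IsDominant d v ε θa p) (hq : IsDominant d v ε θb q)
    (J : Finset (Fin m)) (hJ : ∀ b, (p.1⁻¹ * q.1) b ∈ J ↔ b ∈ J) (hdiff : ∃ b ∈ J, p.1 b ≠ q.1 b ∨ p.2 b ≠ q.2 b)
    (hshort : (J.filter fun b => q.2 b ≠ p.2 b).card ≤ c) :
    (m * Δ + 1) * ∑ b ∈ J, W (sc (p.2 b)) + ∑ b ∈ J, (d (p.2 b) - B (sc (p.2 b))) + 1 ≤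
      (m * Δ + 1) * ∑ b ∈ J, W (sc (q.2 b)) + ∑ b ∈ J, (d (q.2 b) - B (sc (q.2 b))) := by
  classical
  have hD : ∀ r : Fin m → Fin K, ∑ b ∈ J, d (r b) = ∑ b ∈ J, B (sc (r b)) + ∑ b ∈ J, (d (r b) - B (sc (r b))) := by
    intro r; rw [← sum_add_distrib]; exact sum_congr rfl fun b _ => by have := (hd (r b)).1; omega
  have hFle : ∀ r : Fin m → Fin K, ∑ b ∈ J, (d (r b) - B (sc (r b))) ≤ m * Δ := by
    intro r
    calc ∑ b ∈ J, (d (r b) - B (sc (r b))) ≤ ∑ _b ∈ J, Δ := sum_le_sum fun b _ => by have := (hd (r b)).2; omega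
      _ = J.card * Δ := by rw [sum_const, smul_eq_mul]
      _ ≤ m * Δ := Nat.mul_le_mul_right _ (by simpa using card_le_univ J)
  have hFstep := sum_le_sum_add_mul_card_ne_on J p.2 q.2 (fun l => d l - B (sc l)) Δ (fun l => by have := (hd l).2; omega)
  -- the cyclewise slope law on `J`, uncast
  have hslopeZ := sum_d_lt_of_isDominant_invariant d v ε hab (σ₁ := p.1) (σ₂ := q.1) (l₁ := p.2) (l₂ := q.2) hp hq J hJ hdiff
  have hslope : ∑ b ∈ J, d (p.2 b) + 1 ≤ ∑ b ∈ J, d (q.2 b) := by exact_mod_cast hslopeZ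
  have hGp := sum_eq_sum_card_mul_on J (fun b => sc (p.2 b)) (fun b => hsc _) B
  have hGq := sum_eq_sum_card_mul_on J (fun b => sc (q.2 b)) (fun b => hsc _) B
  have hΦp := sum_eq_sum_card_mul_on J (fun b => sc (p.2 b)) (fun b => hsc _) W
  have hΦq := sum_eq_sum_card_mul_on J (fun b => sc (q.2 b)) (fun b => hsc _) W
  have hsum : ∑ t ∈ range s, (J.filter fun b => sc (p.2 b) = t).card =
      ∑ t ∈ range s, (J.filter fun b => sc (q.2 b) = t).card := by
    rw [sum_card_fiber_on J (fun b => sc (p.2 b)) (fun b => hsc _), sum_card_fiber_on J (fun b => sc (q.2 b)) (fun b => hsc _)]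
  have hpos : ∑ t ∈ range s, ((J.filter fun b => sc (q.2 b) = t).card - (J.filter fun b => sc (p.2 b) = t).card) ≤ c := by
    refine (sum_card_tsub_le_card_ne_on J (fun b => sc (p.2 b)) (fun b => sc (q.2 b)) (fun b => hsc _)).trans ?_
    refine le_trans (card_le_card fun b hb => ?_) hshort
    simp only [mem_filter, ne_eq] at hb ⊢
    exact ⟨hb.1, fun h => hb.2 (by rw [h])⟩
  have hG : ∑ t ∈ range s, (J.filter fun b => sc (p.2 b) = t).card * B t + 1 ≤
      ∑ t ∈ range s, (J.filter fun b => sc (q.2 b) = t).card * B t + c * Δ := by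
    rw [← hGp, ← hGq]
    have e1 := hD p.2
    have e2 := hD q.2
    have : Δ * (J.filter fun b => q.2 b ≠ p.2 b).card ≤ c * Δ := by rw [mul_comm]; exact Nat.mul_le_mul_right _ hshort
    omega
  rcases lexStep c Δ hc B W hB hW _ _ hsum hpos hG with hneutral | hrise
  · have hGeq : ∑ b ∈ J, B (sc (p.2 b)) = ∑ b ∈ J, B (sc (q.2 b)) := by
      rw [hGp, hGq]; exact sum_congr rfl fun t ht => by rw [hneutral t ht]
    have hΦeq : ∑ b ∈ J, W (sc (p.2 b)) = ∑ b ∈ J, W (sc (q.2 b)) := by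
      rw [hΦp, hΦq]; exact sum_congr rfl fun t ht => by rw [hneutral t ht]
    have e1 := hD p.2
    have e2 := hD q.2
    rw [hΦeq]
    omega
  · rw [← hΦp, ← hΦq] at hrise
    have := hFle p.2
    nlinarith [hFle q.2, Nat.zero_le (∑ b ∈ J, (d (q.2 b) - B (sc (q.2 b))))]

/-- **A SHORT INVARIANT COVER MAKES THE STEP FREE**: a labelling `π` invariant under `σ⁻¹σ′` (fibres = unions of exchange cycles)
all of whose fibres re-class at most `c` columns gives `Ψ p + 1 ≤ Ψ q`, however many columns the step re-classes in total. [this file] -/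
theorem psi_lt_of_shortCover {s : ℕ} (c Δ : ℕ) (hc : 1 ≤ c) (sc : Fin K → ℕ) (hsc : ∀ l, sc l < s) (B W : ℕ → ℕ)
    (d : Fin K → ℕ) (hd : ∀ l, B (sc l) ≤ d l ∧ d l ≤ B (sc l) + Δ)
    (hB : ∀ t t', t < t' → t' < s → c * (B t + Δ) < B t')
    (hW : ∀ t t', t < t' → t' < s → c * W t + 1 ≤ W t')
    (v ε : Fin m → Fin m → Fin K → ℤ) {θa θb : ℤ} (hab : θa < θb)
    {p q : Equiv.Perm (Fin m) × (Fin m → Fin K)} (hne : p ≠ q) (hp : IsDominant d v ε θa p) (hq : IsDominant d v ε θb q)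
    (π : Fin m → Fin m) (hπ : ∀ b, π ((p.1⁻¹ * q.1) b) = π b)
    (hshort : ∀ i, ((univ.filter fun b => π b = i).filter fun b => q.2 b ≠ p.2 b).card ≤ c) :
    (m * Δ + 1) * ∑ b, W (sc (p.2 b)) + ∑ b, (d (p.2 b) - B (sc (p.2 b))) + 1 ≤
      (m * Δ + 1) * ∑ b, W (sc (q.2 b)) + ∑ b, (d (q.2 b) - B (sc (q.2 b))) := by
  classical
  -- the block potential, and its fibrewise decomposition along `π`
  set ψ : (Fin m → Fin K) → Finset (Fin m) → ℕ := fun r J =>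
    (m * Δ + 1) * ∑ b ∈ J, W (sc (r b)) + ∑ b ∈ J, (d (r b) - B (sc (r b))) with hψ
  have hsplit : ∀ r : Fin m → Fin K, ψ r univ = ∑ i, ψ r (univ.filter fun b => π b = i) := by
    intro r
    simp only [hψ]
    rw [← sum_fiberwise (s := (univ : Finset (Fin m))) (g := π) (f := fun b => W (sc (r b))),
      ← sum_fiberwise (s := (univ : Finset (Fin m))) (g := π) (f := fun b => d (r b) - B (sc (r b))),
      mul_sum, ← sum_add_distrib]
  -- each fibre is invariant; on it the potential rises weakly, strictly where the terms differ
  have hinv : ∀ i b, (p.1⁻¹ * q.1) b ∈ (univ.filter fun b => π b = i) ↔ b ∈ (univ.filter fun b => π b = i) := by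
    intro i b; simp only [mem_filter, mem_univ, true_and, hπ b]
  have hmono : ∀ i, ψ p.2 (univ.filter fun b => π b = i) ≤ ψ q.2 (univ.filter fun b => π b = i) := by
    intro i
    by_cases hdiff : ∃ b ∈ (univ.filter fun b => π b = i), p.1 b ≠ q.1 b ∨ p.2 b ≠ q.2 b
    · have := psiOn_lt_of_short_invariant c Δ hc sc hsc B W d hd hB hW v ε hab hp hq _ (hinv i) hdiff (hshort i)
      simp only [hψ]; omega
    · push Not at hdiff
      simp only [hψ]
      have e1 : ∑ b ∈ univ.filter (fun b => π b = i), W (sc (p.2 b)) = ∑ b ∈ univ.filter (fun b => π b = i), W (sc (q.2 b)) :=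
        sum_congr rfl fun b hb => by rw [(hdiff b hb).2]
      have e2 : ∑ b ∈ univ.filter (fun b => π b = i), (d (p.2 b) - B (sc (p.2 b))) =
          ∑ b ∈ univ.filter (fun b => π b = i), (d (q.2 b) - B (sc (q.2 b))) :=
        sum_congr rfl fun b hb => by rw [(hdiff b hb).2]
      rw [e1, e2]
  -- some fibre sees the difference
  obtain ⟨b₀, hb₀⟩ : ∃ b, p.1 b ≠ q.1 b ∨ p.2 b ≠ q.2 b := by
    by_contra hcon
    push Not at hcon
    exact hne (Prod.ext (Equiv.ext fun b => (hcon b).1) (funext fun b => (hcon b).2))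
  have hstrict : ψ p.2 (univ.filter fun b => π b = π b₀) + 1 ≤ ψ q.2 (univ.filter fun b => π b = π b₀) := by
    have := psiOn_lt_of_short_invariant c Δ hc sc hsc B W d hd hB hW v ε hab hp hq _ (hinv (π b₀))
      ⟨b₀, by simp, hb₀⟩ (hshort (π b₀))
    simp only [hψ]; omega
  have htot : ψ p.2 univ + 1 ≤ ψ q.2 univ := by
    rw [hsplit p.2, hsplit q.2, ← add_sum_erase univ _ (mem_univ (π b₀)), ← add_sum_erase univ _ (mem_univ (π b₀))]
    have hrest := sum_le_sum (s := univ.erase (π b₀)) fun i _ => hmono i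
    omega
  simpa [hψ] using htot

open Classical in
/-- **THE CYCLEWISE SCALE-CARRY LAW**: `n + 1 ≤ ((mΔ+1)·m·W(s−1) + mΔ + 1)·(1 + #{scale-carries with NO short invariant cover})` for every
chain of unique optima at strictly increasing integer slopes with distinct consecutive terms of a design with `c`-separated scales; «no short
invariant cover» = every labelling invariant under the step's permutation quotient has a fibre re-classing `> c` columns (finest labelling:
some single exchange cycle re-classes `> c` columns).  Refines `chain_succ_le_of_longCarries`. [this file] -/
theorem chain_succ_le_of_longCycleCarries {s : ℕ} (c Δ : ℕ) (hc : 1 ≤ c) (sc : Fin K → ℕ) (hsc : ∀ l, sc l < s)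
    (B W : ℕ → ℕ) (d : Fin K → ℕ) (hd : ∀ l, B (sc l) ≤ d l ∧ d l ≤ B (sc l) + Δ)
    (hB : ∀ t t', t < t' → t' < s → c * (B t + Δ) < B t')
    (hW : ∀ t t', t < t' → t' < s → c * W t + 1 ≤ W t')
    (v ε : Fin m → Fin m → Fin K → ℤ) {n : ℕ} (θ : Fin (n + 1) → ℤ)
    (p : Fin (n + 1) → Equiv.Perm (Fin m) × (Fin m → Fin K))
    (hθ : StrictMono θ) (hdom : ∀ k, IsDominant d v ε (θ k) (p k)) (hne : ∀ k : Fin n, p k.castSucc ≠ p k.succ) :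
    n + 1 ≤ ((m * Δ + 1) * (m * W (s - 1)) + m * Δ + 1) *
      ((univ.filter fun k : Fin n =>
        (¬ ∀ t : ℕ, (univ.filter fun b => t ≤ sc ((p k.castSucc).2 b)).card ≤
            (univ.filter fun b => t ≤ sc ((p k.succ).2 b)).card) ∧
        ∀ π : Fin m → Fin m, (∀ b, π (((p k.castSucc).1⁻¹ * (p k.succ).1) b) = π b) →
          ∃ i, c < ((univ.filter fun b => π b = i).filter fun b => (p k.succ).2 b ≠ (p k.castSucc).2 b).card).card + 1) := by
  classical
  set Ψ : Fin (n + 1) → ℕ := fun k => (m * Δ + 1) * ∑ b, W (sc ((p k).2 b)) + ∑ b, (d ((p k).2 b) - B (sc ((p k).2 b)))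
    with hΨ
  set R := (m * Δ + 1) * (m * W (s - 1)) + m * Δ with hR
  set bad : Fin n → Prop := fun k =>
    (¬ ∀ t : ℕ, (univ.filter fun b => t ≤ sc ((p k.castSucc).2 b)).card ≤
        (univ.filter fun b => t ≤ sc ((p k.succ).2 b)).card) ∧
    ∀ π : Fin m → Fin m, (∀ b, π (((p k.castSucc).1⁻¹ * (p k.succ).1) b) = π b) →
      ∃ i, c < ((univ.filter fun b => π b = i).filter fun b => (p k.succ).2 b ≠ (p k.castSucc).2 b).card with hbad
  set L := (univ.filter fun k : Fin n => bad k).card with hL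
  have hups := card_ups_le Ψ R (fun k => psi_le c Δ hc sc hsc B W d hd hW (p k).2)
  have hgoodrise : ∀ k : Fin n, ¬ bad k → Ψ k.castSucc + 1 ≤ Ψ k.succ := by
    intro k hk
    simp only [hbad, not_and_or, not_not] at hk
    rcases hk with hup | hcov
    · exact psi_lt_of_upper_le c Δ hc sc hsc B W d hd hW v ε (hθ Fin.castSucc_lt_succ) (hne k) (hdom _) (hdom _) hup
    · push Not at hcov
      obtain ⟨π, hπ, hshort⟩ := hcov
      exact psi_lt_of_shortCover c Δ hc sc hsc B W d hd hB hW v ε (hθ Fin.castSucc_lt_succ) (hne k) (hdom _) (hdom _) π hπ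
        hshort
  have hgood : (univ.filter fun k : Fin n => ¬ bad k).card ≤ (univ.filter fun k : Fin n => Ψ k.castSucc < Ψ k.succ).card := by
    refine card_le_card fun k hk => ?_
    rw [mem_filter] at hk ⊢
    exact ⟨mem_univ _, by have := hgoodrise k hk.2; omega⟩
  have hdrop : (univ.filter fun k : Fin n => Ψ k.succ < Ψ k.castSucc).card ≤ L := by
    refine card_le_card fun k hk => ?_
    rw [mem_filter] at hk ⊢
    refine ⟨mem_univ _, ?_⟩
    by_contra hkb
    have := hgoodrise k hkb
    omega
  have hn := card_filter_add_card_filter_not (s := (univ : Finset (Fin n))) bad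
  rw [card_univ, Fintype.card_fin] at hn
  have hmul : R * ((univ.filter fun k : Fin n => Ψ k.succ < Ψ k.castSucc).card + 1) ≤ R * (L + 1) :=
    Nat.mul_le_mul_left _ (by omega)
  nlinarith [hups, hgood, hdrop, hn, hmul]

end Blocks
/-! ## 3. Charging each long carry its actual potential drop (the `c`-parametrised displacement law) -/

section Charged
variable {m K : ℕ}

/-- weighted telescoping: good steps (strict rises) number at most `R` plus the total drop over the bad steps. [folklore] -/
theorem card_not_le_add_sum_drop {n : ℕ} (x : Fin (n + 1) → ℕ) (R : ℕ) (hx : ∀ k, x k ≤ R) (bad : Fin n → Prop)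
    [DecidablePred bad] (hgood : ∀ k, ¬ bad k → x k.castSucc < x k.succ) :
    (univ.filter fun k => ¬ bad k).card ≤ R + ∑ k ∈ univ.filter (fun k => bad k), (x k.castSucc - x k.succ) := by
  have hstep : ∀ k : Fin n, x k.succ + (x k.castSucc - x k.succ) = x k.castSucc + (x k.succ - x k.castSucc) := by
    intro k; omega
  have htel : ∑ k : Fin n, (x k.succ - x k.castSucc) + x 0 = x (Fin.last n) + ∑ k : Fin n, (x k.castSucc - x k.succ) := by
    have h1 : ∑ k : Fin n, x k.succ + ∑ k : Fin n, (x k.castSucc - x k.succ) =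
        ∑ k : Fin n, x k.castSucc + ∑ k : Fin n, (x k.succ - x k.castSucc) := by
      rw [← sum_add_distrib, ← sum_add_distrib]; exact sum_congr rfl fun k _ => hstep k
    have h2 : ∑ j : Fin (n + 1), x j = x 0 + ∑ k : Fin n, x k.succ := Fin.sum_univ_succ x
    have h3 : ∑ j : Fin (n + 1), x j = ∑ k : Fin n, x k.castSucc + x (Fin.last n) := Fin.sum_univ_castSucc x
    omega
  have hups : (univ.filter fun k => ¬ bad k).card ≤ ∑ k : Fin n, (x k.succ - x k.castSucc) := by
    rw [card_eq_sum_ones, ← sum_filter_add_sum_filter_not univ (fun k => ¬ bad k) (fun k => x k.succ - x k.castSucc)]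
    refine le_add_right (sum_le_sum fun k hk => ?_)
    have := hgood k (mem_filter.mp hk).2
    omega
  have hdowns : ∑ k : Fin n, (x k.castSucc - x k.succ) = ∑ k ∈ univ.filter (fun k => bad k), (x k.castSucc - x k.succ) := by
    rw [← sum_filter_add_sum_filter_not univ (fun k => bad k) (fun k => x k.castSucc - x k.succ)]
    have h0 : ∑ k ∈ univ.filter (fun k => ¬ bad k), (x k.castSucc - x k.succ) = 0 :=
      sum_eq_zero fun k hk => by have := hgood k (mem_filter.mp hk).2; omega
    rw [h0, add_zero]
  have hlast := hx (Fin.last n)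
  omega

/-- `Ψ` drops by at most `((mΔ+1)·W(s−1) + Δ)` per re-classed column (no dominance needed). [this file] -/
theorem psi_le_psi_add_mul_card_ne {s : ℕ} (c Δ : ℕ) (hc : 1 ≤ c) (sc : Fin K → ℕ) (hsc : ∀ l, sc l < s) (B W : ℕ → ℕ)
    (d : Fin K → ℕ) (hd : ∀ l, B (sc l) ≤ d l ∧ d l ≤ B (sc l) + Δ)
    (hW : ∀ t t', t < t' → t' < s → c * W t + 1 ≤ W t') (r r' : Fin m → Fin K) :
    (m * Δ + 1) * ∑ b, W (sc (r b)) + ∑ b, (d (r b) - B (sc (r b))) ≤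
      (m * Δ + 1) * ∑ b, W (sc (r' b)) + ∑ b, (d (r' b) - B (sc (r' b))) +
        ((m * Δ + 1) * W (s - 1) + Δ) * (univ.filter fun b => r b ≠ r' b).card := by
  classical
  have hWle : ∀ l, W (sc l) ≤ W (s - 1) := by
    intro l
    rcases Nat.lt_or_ge (sc l) (s - 1) with h | h
    · have h1 := hW (sc l) (s - 1) h (by have := hsc l; omega)
      have h2 : W (sc l) ≤ c * W (sc l) := Nat.le_mul_of_pos_left _ (by omega)
      omega
    · have : sc l = s - 1 := by have := hsc l; omega
      rw [this]
  -- the compressed potential drops by ≤ W(s−1) per changed column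
  have hΦ : ∑ b, W (sc (r b)) ≤ ∑ b, W (sc (r' b)) + W (s - 1) * (univ.filter fun b => r b ≠ r' b).card := by
    rw [← sum_filter_add_sum_filter_not univ (fun b => r b ≠ r' b) (fun b => W (sc (r b))),
      ← sum_filter_add_sum_filter_not univ (fun b => r b ≠ r' b) (fun b => W (sc (r' b)))]
    have h1 : ∑ b ∈ univ.filter (fun b => r b ≠ r' b), W (sc (r b)) ≤ W (s - 1) * (univ.filter fun b => r b ≠ r' b).card := by
      calc ∑ b ∈ univ.filter (fun b => r b ≠ r' b), W (sc (r b)) ≤ ∑ b ∈ univ.filter (fun b => r b ≠ r' b), W (s - 1) :=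
            sum_le_sum fun b _ => hWle _
        _ = W (s - 1) * (univ.filter fun b => r b ≠ r' b).card := by rw [sum_const, smul_eq_mul, mul_comm]
    have h2 : ∑ b ∈ univ.filter (fun b => ¬ r b ≠ r' b), W (sc (r b)) = ∑ b ∈ univ.filter (fun b => ¬ r b ≠ r' b), W (sc (r' b)) :=
      sum_congr rfl fun b hb => by
        have : r b = r' b := by simpa using (mem_filter.mp hb).2
        rw [this]
    have h3 := Nat.zero_le (∑ b ∈ univ.filter (fun b => r b ≠ r' b), W (sc (r' b)))
    omega
  -- the fine part drops by ≤ Δ per changed column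
  have hF := sum_le_sum_add_mul_card_ne r' r (fun l => d l - B (sc l)) Δ (fun l => by have := (hd l).2; omega)
  have hmul := Nat.mul_le_mul_left (m * Δ + 1) hΦ
  nlinarith [hmul, hF]

open Classical in
/-- **THE CHARGED FORM** (`c`-parametrised displacement law): `n ≤ R + Σ_{k bad} (((mΔ+1)·W(s−1) + Δ)·ℓ_k + 1)` with
`R = (mΔ+1)·m·W(s−1) + mΔ`, `bad` as in the cyclewise law and `ℓ_k` = columns re-classed at step `k`; each summand is `≤ R + 1`, and for
`Δ = 0`, `c = 1`, `W = id` this is the carry-restricted form of …Displacement `steps_le_pred_mul_add_displacement`. [this file] -/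
theorem chain_le_add_sum_charge {s : ℕ} (c Δ : ℕ) (hc : 1 ≤ c) (sc : Fin K → ℕ) (hsc : ∀ l, sc l < s)
    (B W : ℕ → ℕ) (d : Fin K → ℕ) (hd : ∀ l, B (sc l) ≤ d l ∧ d l ≤ B (sc l) + Δ)
    (hB : ∀ t t', t < t' → t' < s → c * (B t + Δ) < B t')
    (hW : ∀ t t', t < t' → t' < s → c * W t + 1 ≤ W t')
    (v ε : Fin m → Fin m → Fin K → ℤ) {n : ℕ} (θ : Fin (n + 1) → ℤ)
    (p : Fin (n + 1) → Equiv.Perm (Fin m) × (Fin m → Fin K))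
    (hθ : StrictMono θ) (hdom : ∀ k, IsDominant d v ε (θ k) (p k)) (hne : ∀ k : Fin n, p k.castSucc ≠ p k.succ) :
    n ≤ ((m * Δ + 1) * (m * W (s - 1)) + m * Δ) +
      ∑ k ∈ univ.filter (fun k : Fin n =>
        (¬ ∀ t : ℕ, (univ.filter fun b => t ≤ sc ((p k.castSucc).2 b)).card ≤
            (univ.filter fun b => t ≤ sc ((p k.succ).2 b)).card) ∧
        ∀ π : Fin m → Fin m, (∀ b, π (((p k.castSucc).1⁻¹ * (p k.succ).1) b) = π b) →
          ∃ i, c < ((univ.filter fun b => π b = i).filter fun b => (p k.succ).2 b ≠ (p k.castSucc).2 b).card),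
        (((m * Δ + 1) * W (s - 1) + Δ) * (univ.filter fun b => (p k.castSucc).2 b ≠ (p k.succ).2 b).card + 1) := by
  classical
  set Ψ : Fin (n + 1) → ℕ := fun k => (m * Δ + 1) * ∑ b, W (sc ((p k).2 b)) + ∑ b, (d ((p k).2 b) - B (sc ((p k).2 b)))
    with hΨ
  set R := (m * Δ + 1) * (m * W (s - 1)) + m * Δ with hR
  set bad : Fin n → Prop := fun k =>
    (¬ ∀ t : ℕ, (univ.filter fun b => t ≤ sc ((p k.castSucc).2 b)).card ≤
        (univ.filter fun b => t ≤ sc ((p k.succ).2 b)).card) ∧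
    ∀ π : Fin m → Fin m, (∀ b, π (((p k.castSucc).1⁻¹ * (p k.succ).1) b) = π b) →
      ∃ i, c < ((univ.filter fun b => π b = i).filter fun b => (p k.succ).2 b ≠ (p k.castSucc).2 b).card with hbad
  have hgoodrise : ∀ k : Fin n, ¬ bad k → Ψ k.castSucc < Ψ k.succ := by
    intro k hk
    simp only [hbad, not_and_or, not_not] at hk
    rcases hk with hup | hcov
    · have := psi_lt_of_upper_le c Δ hc sc hsc B W d hd hW v ε (hθ Fin.castSucc_lt_succ) (hne k) (hdom _) (hdom _) hup
      simp only [hΨ]; omega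
    · push Not at hcov
      obtain ⟨π, hπ, hshort⟩ := hcov
      have := psi_lt_of_shortCover c Δ hc sc hsc B W d hd hB hW v ε (hθ Fin.castSucc_lt_succ) (hne k) (hdom _) (hdom _) π hπ
        hshort
      simp only [hΨ]; omega
  have htel := card_not_le_add_sum_drop Ψ R (fun k => psi_le c Δ hc sc hsc B W d hd hW (p k).2) bad hgoodrise
  -- the drop at a bad step is at most the charge of its re-classed columns
  have hcharge : ∀ k : Fin n, Ψ k.castSucc - Ψ k.succ ≤
      ((m * Δ + 1) * W (s - 1) + Δ) * (univ.filter fun b => (p k.castSucc).2 b ≠ (p k.succ).2 b).card := by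
    intro k
    have := psi_le_psi_add_mul_card_ne c Δ hc sc hsc B W d hd hW (p k.castSucc).2 (p k.succ).2
    simp only [hΨ]; omega
  have hsum : ∑ k ∈ univ.filter (fun k => bad k), (Ψ k.castSucc - Ψ k.succ) ≤
      ∑ k ∈ univ.filter (fun k => bad k),
        (((m * Δ + 1) * W (s - 1) + Δ) * (univ.filter fun b => (p k.castSucc).2 b ≠ (p k.succ).2 b).card) :=
    sum_le_sum fun k _ => hcharge k
  have hn := card_filter_add_card_filter_not (s := (univ : Finset (Fin n))) (fun k => bad k)
  rw [card_univ, Fintype.card_fin] at hn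
  have hbadcard : (univ.filter fun k => bad k).card = ∑ k ∈ univ.filter (fun k => bad k), 1 := by rw [card_eq_sum_ones]
  show n ≤ R + ∑ k ∈ univ.filter (fun k => bad k),
    (((m * Δ + 1) * W (s - 1) + Δ) * (univ.filter fun b => (p k.castSucc).2 b ≠ (p k.succ).2 b).card + 1)
  rw [sum_add_distrib]
  omega

end Charged

end Summit.ValiantsHypothesis.ValiantsHypothesis.Theorems.KPlusLogSqLaw.ScaleCarries
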